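import Mathlib
import Summits.NavierStokesRegularity.NavierStokesRegularity.Theses.AxisymmetricExtremality
import Literature.Analysis.FluidPDE.AxisymmetricEuler

/-!
# Strategy census s20-g23 (family `s`, independent) — typed objects for crux `AxisymmetricKatoGlobal`

Crux item `stmt-NavierStokesRegularity-15453` of route `AxisymmetricExtremality`.
This file is a census SKETCH (planner, crux-strategist seat): it records, as elaborating Lean,
the attempts made under the headings Weaker-intermediate / Decomposition / Strengthen of
`STRATEGY-CENSUS-s20-g23.md`.  Nothing here is a route item, nothing restates or weakens the
crux on the ledger; every `theorem` below is pure logic (no `sorry`).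

* §1 the WEAKEST statement the route's deciding theorem actually consumes
  (`ThresholdGivenClayFailure`, "T₀") and the proof that the same glue closes the summit from it;
  `S → T₀` and `S → MinimalDatumPFold`, hence `S ↔ MinimalDatumPFold ∧ T₀` given the proved
  item `PFoldToAxisymmetric`.
* §2 the only typed 2-piece split of the crux found whose assembly is provable
  (`AxisymSchwartzKatoGlobal ∧ CriticalToSchwartzTransfer → AxisymmetricKatoGlobal`);
  piece A is ns.S25 (axisymmetric-with-swirl regularity) in Kato form, piece B is open.
* §3 the strengthening S⁺ (quantitative a-priori bound) and `S⁺ → crux`.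
-/

set_option linter.dupNamespace false

namespace Summit.NavierStokesRegularity.NavierStokesRegularity.Cruxes.AxisymmetricKatoGlobal.StrategistS20g23

open Summit.NavierStokesRegularity.NavierStokesRegularity
open Summit.NavierStokesRegularity.NavierStokesRegularity.Theses.AxisymmetricExtremality
open MeasureTheory

/-! ## §0 Vocabulary (verbatim clauses of the route file) -/

/-- The rotation-invariance clause of the crux, verbatim (= `IsAxisymmetric`, see below). -/
def RotInv (u₀ : EuclideanSpace ℝ (Fin 3) → EuclideanSpace ℝ (Fin 3)) : Prop :=
  ∀ (θ : ℝ) (x : EuclideanSpace ℝ (Fin 3)),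
    u₀ (WithLp.toLp 2 ![Real.cos θ * x 0 - Real.sin θ * x 1, Real.sin θ * x 0 + Real.cos θ * x 1, x 2]) =
      WithLp.toLp 2 ![Real.cos θ * u₀ x 0 - Real.sin θ * u₀ x 1, Real.sin θ * u₀ x 0 + Real.cos θ * u₀ x 1, u₀ x 2]

/-- The crux's symmetry clause is literally `Literature.Analysis.FluidPDE.IsAxisymmetric`. -/
theorem rotInv_iff_isAxisymmetric (u₀ : EuclideanSpace ℝ (Fin 3) → EuclideanSpace ℝ (Fin 3)) :
    RotInv u₀ ↔ Literature.Analysis.FluidPDE.IsAxisymmetric u₀ := Iff.rfl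

/-- "Clay (A) fails at viscosity `ν`": the verbatim antecedent of the route item `MinimalDatumPFold`. -/
def ClayFailsAt (ν : ℝ) : Prop :=
  ∃ v₀ : EuclideanSpace ℝ (Fin 3) → EuclideanSpace ℝ (Fin 3), ContDiff ℝ (⊤ : ℕ∞) v₀ ∧
    Literature.Analysis.FluidPDE.NSWave0.IsDivFree v₀ ∧ Literature.Analysis.FluidPDE.HasRapidSpatialDecay v₀ ∧
    ¬ ∃ (u : ℝ → EuclideanSpace ℝ (Fin 3) → EuclideanSpace ℝ (Fin 3)) (p : ℝ → EuclideanSpace ℝ (Fin 3) → ℝ),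
      Literature.Analysis.FluidPDE.IsSmoothOnHalfSpace u ∧ Literature.Analysis.FluidPDE.IsSmoothOnHalfSpace p ∧
      Literature.Analysis.FluidPDE.IsNavierStokesSolution ν 0 v₀ u p ∧ Literature.Analysis.FluidPDE.HasBoundedEnergy u

/-- An axisymmetric `Ḣ^{1/2}`-minimal blow-up datum exists at viscosity `ν`
(the consequent of the proved item `PFoldToAxisymmetric`). -/
def HasAxisymMinimalBlowup (ν : ℝ) : Prop :=
  ∃ (u₀ : EuclideanSpace ℝ (Fin 3) → EuclideanSpace ℝ (Fin 3))
    (g : Literature.Analysis.FunctionSpaces.HomSobolev (EuclideanSpace ℝ (Fin 3)) (EuclideanSpace ℂ (Fin 3)) (1 / 2 : ℝ)),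
    Literature.Analysis.FluidPDE.IsMinimalBlowupDatum ν u₀ g ∧ RotInv u₀

/-! ## §1 Weakest intermediate consumed by the glue -/

/-- `T` (threshold instance): for every `ν > 0` there is NO axisymmetric minimal blow-up datum. -/
def NoAxisymMinimalBlowup : Prop := ∀ ν : ℝ, 0 < ν → ¬ HasAxisymMinimalBlowup ν

/-- `T₀` (the weakest statement the route's `closes` consumes): at any viscosity where Clay (A)
fails, there is no axisymmetric minimal blow-up datum. -/
def ThresholdGivenClayFailure : Prop := ∀ ν : ℝ, 0 < ν → ClayFailsAt ν → ¬ HasAxisymMinimalBlowup ν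

/-- crux ⇒ T (the glue uses the crux only through this). -/
theorem noAxisymMinimalBlowup_of_crux (h : AxisymmetricKatoGlobal) : NoAxisymMinimalBlowup := by
  rintro ν hν ⟨u₀, g, ⟨hL3, hrep, hdiv, -, hnot⟩, hax⟩
  exact hnot (h ν hν u₀ g hL3 hrep hdiv hax)

/-- T ⇒ T₀. -/
theorem thresholdGivenClayFailure_of_noAxisym (h : NoAxisymMinimalBlowup) : ThresholdGivenClayFailure :=
  fun ν hν _ => h ν hν

/-- S ⇒ T₀ (vacuously: under S Clay never fails), so T₀ can never be refuted while S stands. -/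
theorem thresholdGivenClayFailure_of_summit (hS : NavierStokesRegularity) : ThresholdGivenClayFailure := by
  have hS' : Literature.NS.NavierStokesExistenceSmoothR3 := hS
  intro ν hν ⟨v₀, hsm, hdiv, hdec, hno⟩
  exact (hno (hS' ν hν v₀ hsm hdiv hdec)).elim

/-- S ⇒ MinimalDatumPFold (same vacuity): the rank-2 crux is summit-implied. -/
theorem minimalDatumPFold_of_summit (hS : NavierStokesRegularity) : MinimalDatumPFold := by
  have hS' : Literature.NS.NavierStokesExistenceSmoothR3 := hS
  intro ν hν ⟨v₀, hsm, hdiv, hdec, hno⟩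
  exact (hno (hS' ν hν v₀ hsm hdiv hdec)).elim

/-- The route's deciding theorem with the crux replaced by `T₀`: same `by_contra` logic. -/
theorem closes_via_threshold (h₂ : MinimalDatumPFold) (h₄ : PFoldToAxisymmetric)
    (hT : ThresholdGivenClayFailure) : NavierStokesRegularity := by
  show Literature.NS.NavierStokesExistenceSmoothR3
  intro ν hν u₀ hsm hdiv hdec
  by_contra hno
  have hfail : ClayFailsAt ν := ⟨u₀, hsm, hdiv, hdec, hno⟩
  obtain ⟨u₁, g, hmin, hax⟩ := h₄ ν hν (h₂ ν hν hfail)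
  exact hT ν hν hfail ⟨u₁, g, hmin, hax⟩

/-- Given the PROVED item `PFoldToAxisymmetric`, the summit is equivalent to the conjunction of
the rank-2 crux and `T₀`; i.e. re-gluing `AxisymmetricKatoGlobal ↦ T₀` loses nothing and makes
both remaining binders summit-implied (never refutable while S is true). -/
theorem summit_iff_conjuncts (h₄ : PFoldToAxisymmetric) :
    NavierStokesRegularity ↔ (MinimalDatumPFold ∧ ThresholdGivenClayFailure) :=
  ⟨fun hS => ⟨minimalDatumPFold_of_summit hS, thresholdGivenClayFailure_of_summit hS⟩,
    fun h => closes_via_threshold h.1 h₄ h.2⟩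

/-- Also `T` alone closes, given both other items. -/
theorem closes_via_T (h₂ : MinimalDatumPFold) (h₄ : PFoldToAxisymmetric) (hT : NoAxisymMinimalBlowup) :
    NavierStokesRegularity :=
  closes_via_threshold h₂ h₄ (thresholdGivenClayFailure_of_noAxisym hT)

/-! ## §2 Decomposition attempt (the only typed split with a provable assembly) -/

/-- Piece A (≈ ns.S25, Ladyzhenskaya 1968 / open: axisymmetric WITH swirl), in Kato form:
smooth, divergence-free, rapidly decaying axisymmetric data have global Kato solutions. -/
def AxisymSchwartzKatoGlobal : Prop :=
  ∀ ν : ℝ, 0 < ν → ∀ v₀ : EuclideanSpace ℝ (Fin 3) → EuclideanSpace ℝ (Fin 3), ContDiff ℝ (⊤ : ℕ∞) v₀ →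
    Literature.Analysis.FluidPDE.NSWave0.IsDivFree v₀ → Literature.Analysis.FluidPDE.HasRapidSpatialDecay v₀ →
    RotInv v₀ → Literature.Analysis.FluidPDE.HasGlobalKatoSolution ν v₀

/-- Piece B (critical-to-classical blow-up transfer, OPEN): an axisymmetric critical datum without
a global Kato solution yields a smooth rapidly decaying axisymmetric datum without one. -/
def CriticalToSchwartzTransfer : Prop :=
  ∀ ν : ℝ, 0 < ν → ∀ (u₀ : EuclideanSpace ℝ (Fin 3) → EuclideanSpace ℝ (Fin 3))
    (g : Literature.Analysis.FunctionSpaces.HomSobolev (EuclideanSpace ℝ (Fin 3)) (EuclideanSpace ℂ (Fin 3)) (1 / 2 : ℝ)),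
    MemLp u₀ 3 volume → g.Represents (Literature.Analysis.FunctionSpaces.EuclideanSpace.complexify ∘ u₀) →
    Literature.Analysis.FluidPDE.IsWeaklyDivFree u₀ → RotInv u₀ →
    ¬ Literature.Analysis.FluidPDE.HasGlobalKatoSolution ν u₀ →
    ∃ v₀ : EuclideanSpace ℝ (Fin 3) → EuclideanSpace ℝ (Fin 3), ContDiff ℝ (⊤ : ℕ∞) v₀ ∧
      Literature.Analysis.FluidPDE.NSWave0.IsDivFree v₀ ∧ Literature.Analysis.FluidPDE.HasRapidSpatialDecay v₀ ∧
      RotInv v₀ ∧ ¬ Literature.Analysis.FluidPDE.HasGlobalKatoSolution ν v₀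

/-- Assembly of the split, PROVED: A → B → crux (by name). -/
theorem crux_of_split (hA : AxisymSchwartzKatoGlobal) (hB : CriticalToSchwartzTransfer) :
    AxisymmetricKatoGlobal := by
  intro ν hν u₀ g hL3 hrep hdiv hax
  by_contra hno
  obtain ⟨v₀, hsm, hdv, hdec, hax', hno'⟩ := hB ν hν u₀ g hL3 hrep hdiv hax hno
  exact hno' (hA ν hν v₀ hsm hdv hdec hax')

/-- Piece A is implied by the crux restricted to nothing: crux ⇒ A needs only that Clay-class
axisymmetric data are critical data (`ClayDatumCritical`, a proved support item of the route).
Recorded as an implication from that item's statement, to show A is not a costume of S: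
A speaks of Kato solutions for Schwartz data, S of classical bounded-energy solutions. -/
theorem pieceA_of_crux (hC : ClayDatumCritical) (h : AxisymmetricKatoGlobal) : AxisymSchwartzKatoGlobal := by
  intro ν hν v₀ hsm hdv hdec hax
  obtain ⟨hL3, hdiv, g, hrep⟩ := hC v₀ hsm hdv hdec
  exact h ν hν v₀ g hL3 hrep hdiv hax

/-! ## §3 Strengthening S⁺ (quantitative a-priori bound) -/

/-- S⁺: global Kato solutions for axisymmetric critical data WITH an a-priori `L³` bound
depending only on `ν` and `‖g‖_{Ḣ^{1/2}}`. -/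
def AxisymQuantitativeKatoGlobal : Prop :=
  ∃ F : ℝ → ENNReal → ENNReal, (∀ ν a, a < ⊤ → F ν a < ⊤) ∧
    ∀ ν : ℝ, 0 < ν → ∀ (u₀ : EuclideanSpace ℝ (Fin 3) → EuclideanSpace ℝ (Fin 3))
      (g : Literature.Analysis.FunctionSpaces.HomSobolev (EuclideanSpace ℝ (Fin 3)) (EuclideanSpace ℂ (Fin 3)) (1 / 2 : ℝ)),
      MemLp u₀ 3 volume → g.Represents (Literature.Analysis.FunctionSpaces.EuclideanSpace.complexify ∘ u₀) →
      Literature.Analysis.FluidPDE.IsWeaklyDivFree u₀ → RotInv u₀ →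
      ∃ u : ℝ → EuclideanSpace ℝ (Fin 3) → EuclideanSpace ℝ (Fin 3),
        Literature.Analysis.FluidPDE.IsGlobalMildSolution ν 0 u₀ u ∧
        Literature.Analysis.FluidPDE.ContinuousInLpOn (Set.Ici 0) 3 u ∧ u 0 = u₀ ∧
        AEStronglyMeasurable (Function.uncurry u) (volume.restrict (Set.Ioi 0 ×ˢ Set.univ)) ∧
        ∀ t : ℝ, 0 ≤ t → eLpNorm (u t) 3 volume ≤ F ν ‖g‖ₑ

/-- S⁺ ⇒ crux (forget the bound). -/
theorem crux_of_quantitative (h : AxisymQuantitativeKatoGlobal) : AxisymmetricKatoGlobal := by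
  obtain ⟨F, -, hF⟩ := h
  intro ν hν u₀ g hL3 hrep hdiv hax
  obtain ⟨u, hmild, hcont, h0, hmeas, -⟩ := hF ν hν u₀ g hL3 hrep hdiv hax
  exact ⟨u, hmild, hcont, h0, hmeas⟩

end Summit.NavierStokesRegularity.NavierStokesRegularity.Cruxes.AxisymmetricKatoGlobal.StrategistS20g23
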